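import Mathlib
import Summits.Ventures.HodgeRepro2.T5IndexTwoCharacter

/-!
# The local norm index theorem at a REAL place: `[ℝˣ : N ℂˣ] = 2`, `η_∞ = sign`

The archimedean companion of the finite-place files (`T5AdicCompletionNormGroup`,
`T5QuadraticNormIndex`, `T5LocalNormIndex`): at a real place `v` of `F⁺` below a complex place `w`
of the CM field `F` (`F⁺_v ≃ ℝ`, `F_w ≃ ℂ`, `Gal(ℂ/ℝ) = {1, conj}`), the norm is
`N(z) = z · z̄ = |z|²`, its image is the group of POSITIVE reals, of index `2` in `ℝˣ`, and the
associated sign character `η_∞ : ℝˣ →* ℤˣ` (`T5IndexTwoCharacter.signChar`) is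
`η_∞(x) = 1 ⟺ x > 0`.

* `archNorm : ℂˣ →* ℝˣ` (`Units.map normSq`), `archNorm_apply`, `archNorm_eq_mul_conj`;
* **`range_archNorm : archNorm.range = Units.posSubgroup ℝ`** (a positive real is `|√r|²`);
* **`index_range_archNorm : archNorm.range.index = 2`** (Mathlib `Units.index_posSubgroup`);
* `archNormChar : ℝˣ →* ℤˣ`, **`archNormChar_eq_one_iff (x) : archNormChar x = 1 ↔ 0 < x`**,
  `archNormChar_eq_neg_one_iff`, `archNormChar_neg_one`.

Declaration per README §8(d): «uses an L-value-free non-vanishing device: NO».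
-/

namespace Summit.Ventures.HodgeRepro2.T5ArchimedeanNormGroup

open Complex

/-- The norm `ℂˣ →* ℝˣ`, `z ↦ z · z̄ = |z|²`. -/
noncomputable def archNorm : ℂˣ →* ℝˣ := Units.map (normSq : ℂ →*₀ ℝ).toMonoidHom

/-- `archNorm z = |z|²`. -/
theorem archNorm_apply (z : ℂˣ) : (archNorm z : ℝ) = normSq (z : ℂ) := rfl

/-- `archNorm z = z · z̄` in `ℂ`. -/
theorem archNorm_eq_mul_conj (z : ℂˣ) :
    ((archNorm z : ℝ) : ℂ) = (z : ℂ) * (starRingEnd ℂ) (z : ℂ) := by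
  rw [archNorm_apply, mul_conj]

/-- THE NORM GROUP AT A REAL PLACE: the image of `ℂˣ` is the subgroup of positive reals. -/
theorem range_archNorm : archNorm.range = Units.posSubgroup ℝ := by
  ext x
  constructor
  · rintro ⟨z, rfl⟩
    rw [Units.mem_posSubgroup, archNorm_apply]
    exact normSq_pos.mpr z.ne_zero
  · intro hx
    rw [Units.mem_posSubgroup] at hx
    refine ⟨Units.mk0 ((Real.sqrt (x : ℝ) : ℝ) : ℂ) (ofReal_ne_zero.mpr (Real.sqrt_pos.mpr hx).ne'),
      ?_⟩
    apply Units.ext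
    rw [archNorm_apply, Units.val_mk0, normSq_ofReal, Real.mul_self_sqrt hx.le]

/-- `[ℝˣ : N ℂˣ] = 2`. -/
theorem index_range_archNorm : archNorm.range.index = 2 := by
  rw [range_archNorm]
  exact Units.index_posSubgroup ℝ

/-- `η_∞ : ℝˣ →* ℤˣ`, the sign character of the norm group. -/
noncomputable def archNormChar : ℝˣ →* ℤˣ :=
  T5IndexTwoCharacter.signChar archNorm.range index_range_archNorm

/-- `η_∞(x) = 1 ⟺ x > 0`. -/
theorem archNormChar_eq_one_iff (x : ℝˣ) : archNormChar x = 1 ↔ (0 : ℝ) < x := by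
  rw [archNormChar, T5IndexTwoCharacter.signChar_eq_one_iff, range_archNorm, Units.mem_posSubgroup]

/-- `η_∞(x) = −1 ⟺ x < 0`. -/
theorem archNormChar_eq_neg_one_iff (x : ℝˣ) : archNormChar x = -1 ↔ (x : ℝ) < 0 := by
  rw [archNormChar, T5IndexTwoCharacter.signChar_eq_neg_one_iff, range_archNorm,
    Units.mem_posSubgroup, not_lt]
  exact ⟨fun h => lt_of_le_of_ne h x.ne_zero, fun h => h.le⟩

/-- `η_∞(−1) = −1`. -/
theorem archNormChar_neg_one : archNormChar (-1) = -1 := by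
  rw [archNormChar_eq_neg_one_iff]
  simp

end Summit.Ventures.HodgeRepro2.T5ArchimedeanNormGroup
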